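import Literature.MathematicalPhysics.KineticTheory.InfiniteChainGibbsInvariance
import HarnessLib

/-!
# Fixed-time locality of the Buttà–Marchioro flow of the infinite chain (deterministic part)

Topic `Literature/MathematicalPhysics/KineticTheory`; companion of
`InfiniteChainSuperstableEstimates.lean` / `InfiniteChainSuperstableDynamicsProofs.lean` /
`InfiniteChainGibbsInvariance.lean` (P. Buttà, C. Marchioro, *Dynamics of infinite classical
anharmonic crystals*, J. Stat. Phys. **164** (2016) 680–692, §3, `d = ν = 1`).

For an infinite-volume dynamics `D` of the chain `P` (`U`, `V` even non-negative polynomials)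
whose carrier is BM's good set `𝒳₀ = bmGood P`, the time-`t` map is approximated, at the sites
`-1, 0, 1` and uniformly on compact time intervals and on the sublevel sets `{Q ≤ N}`, by the
severed (partial) dynamics `T^{Λ_{0,n}}_t` of LLL (9a)–(9c) in the box `Λ_{0,n} = [-n, n]`, with
an error `O((1/32)^n)`; and `T^{Λ}_t σ` at a site of `Λ` only depends on `σ` restricted to `Λ`
and its two outer neighbours. This is the deterministic half of the fixed-time `L²` locality
of the flow used for the space-time clustering of local observables.

## Contents (all proved; no definitions, no named facts)

* `OscillatorChain.severedFlow_dependsOn`, `severedFlow_cbox_dependsOn` — locality of the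
  severed flow (uniqueness of severed solutions, `IsSeveredSolution.eq_severedFlow`).
* `InfiniteChainDynamics.tendsto_severedFlow_flow` — canonicity: for ANY dynamics with carrier
  `𝒳₀`, the severed orbits in the boxes `Λ_{μ,n}` converge to its flow on `𝒳₀` (BM (3.3) for the
  flow of `OscillatorChain.exists_bmDynamics` + the `unique` field).
* `InfiniteChainDynamics.exists_flow_sub_severedFlow_le` — the rate (BM (3.14)–(3.16),
  `OscillatorChain.dist_limit_le` with `γ = 1`, `β' = 1`, centre `0`, `k = 1`): for `σ ∈ 𝒳₀`,
  `t ≥ 0`, `n ≥ 4 + A(1 + t²(1+t)Q(σ))`, `|s| ≤ t`, `i ∈ {-1,0,1}`, positions and momenta of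
  `φ_s σ` and `T^{Λ_{0,n}}_s σ` at `i` differ by at most `(2 + 22 t K Q(σ)) (1/32)^{n-1}`.
* `InfiniteChainDynamics.exists_abs_sub_comp_severedFlow_le` — for an observable `a` that is
  polynomially Lipschitz in the coordinates at `-1, 0, 1` (hypothesis `ha`, satisfied by the bond
  current `j₀` and the energy density `h₀`, see `InfiniteChainObservableLipschitz.lean`),
  `|a(φ_s σ) - a(T^{Λ_{0,n}}_s σ)| ≤ C_a (L N (2n+7))^{d_a} (2 + 22 t K N)(1/32)^{n-1}` on
  `{Q ≤ N}`, once `n ≥ 4 + A(1 + t²(1+t)N)` and the last factor is `≤ 1` (energy bounds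
  `severedFlow_energy_bounds`, BM (3.7) `bmLocalEnergy_le`, `exists_constants`).

[cite: ButtaMarchioro2016, §3 eqs. (3.3), (3.7), (3.14)–(3.16)]
-/

noncomputable section

open MeasureTheory Filter Set Function
open scoped Topology BigOperators

namespace Literature.MathematicalPhysics.KineticTheory.HeatConduction

namespace OscillatorChain

variable {P : OscillatorChain} {s₁ s₂ : ℕ}

/-! ### §1 Locality of the severed flow -/

/-- The force at site `i` only involves the positions at `i - 1`, `i`, `i + 1`. [folklore] -/
theorem force_congr_of_eq {σ σ' : ChainConfig} {i : ℤ} (h0 : (σ i).1 = (σ' i).1)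
    (hp : (σ (i + 1)).1 = (σ' (i + 1)).1) (hm : (σ (i - 1)).1 = (σ' (i - 1)).1) :
    P.force σ i = P.force σ' i := by
  rw [force_eq, force_eq, h0, hp, hm]

/-- **Locality of the severed flow** (LLL (9a)–(9c)): for `i ∈ Λ`, the site `(T^Λ_t σ)_i` only
depends on the restriction of `σ` to `Λ` and to the outer neighbours of `Λ` (the configuration
frozen outside `Λ` enters the forces on `Λ` only through the sites adjacent to `Λ`; uniqueness of
severed solutions for `C²` potentials). [cite: LanfordLebowitzLieb1977, §2 eqs. (9a)–(9c)] -/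
theorem severedFlow_dependsOn (hU : ContDiff ℝ 2 P.U) (hV : ContDiff ℝ 2 P.V) (hB1 : P.CondB1)
    (Λ : Finset ℤ) (t : ℝ) {i : ℤ} (hi : i ∈ Λ) :
    DependsOn (fun σ : ChainConfig => severedFlow hB1 Λ t σ i)
      {j : ℤ | j ∈ Λ ∨ j + 1 ∈ Λ ∨ j - 1 ∈ Λ} := by
  classical
  intro σ σ' hσ
  -- the candidate severed solution starting from `σ'`
  set γ' : ℝ → ChainConfig := fun s j => if j ∈ Λ then severedFlow hB1 Λ s σ j else σ' j
    with hγ'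
  have hon : ∀ s, ∀ j ∈ Λ, γ' s j = severedFlow hB1 Λ s σ j := fun s j hj => if_pos hj
  have hoff : ∀ s, ∀ j ∉ Λ, γ' s j = σ' j := fun s j hj => if_neg hj
  -- near a site of `Λ` the candidate agrees with the severed orbit of `σ`
  have hagree : ∀ s, ∀ j ∈ Λ, ∀ l : ℤ, (l = j ∨ l = j + 1 ∨ l = j - 1) →
      γ' s l = severedFlow hB1 Λ s σ l := by
    intro s j hj l hl
    by_cases hlΛ : l ∈ Λ
    · exact hon s l hlΛ
    · rw [hoff s l hlΛ, severedFlow_apply_of_not_mem hB1 Λ s σ hlΛ]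
      refine (hσ l ?_).symm
      rcases hl with rfl | rfl | rfl
      · exact Or.inl hj
      · exact Or.inr (Or.inr (by simpa using hj))
      · exact Or.inr (Or.inl (by simpa using hj))
  have hsol : P.IsSeveredSolution Λ γ' := by
    refine ⟨fun j hj s => ?_, fun j hj s => ?_⟩
    · have hsev := (isSeveredSolution_severedFlow hB1 Λ σ).1 j hj s
      have e1 : (fun s => (γ' s j).1) = fun s => (severedFlow hB1 Λ s σ j).1 :=
        funext fun s => by rw [hon s j hj]
      have e2 : (fun s => (γ' s j).2) = fun s => (severedFlow hB1 Λ s σ j).2 :=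
        funext fun s => by rw [hon s j hj]
      have eF : P.force (γ' s) j = P.force (severedFlow hB1 Λ s σ) j :=
        force_congr_of_eq (congrArg Prod.fst (hagree s j hj j (Or.inl rfl)))
          (congrArg Prod.fst (hagree s j hj (j + 1) (Or.inr (Or.inl rfl))))
          (congrArg Prod.fst (hagree s j hj (j - 1) (Or.inr (Or.inr rfl))))
      rw [e1, e2, hon s j hj, eF]
      exact hsev
    · rw [hoff s j hj, hoff 0 j hj]
  have h0 : γ' 0 = σ' := by
    funext j
    by_cases hj : j ∈ Λ
    · rw [hon 0 j hj, severedFlow_zero]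
      exact hσ j (Or.inl hj)
    · exact hoff 0 j hj
  have key := hsol.eq_severedFlow (hB1 := hB1) hU hV t
  rw [h0] at key
  have h := congrFun key i
  rw [hon t i hi] at h
  exact h

/-- **Locality of the severed flow in a box**: for `i ∈ Λ_{m,n} = [m-n, m+n]`, `(T^{Λ_{m,n}}_t σ)_i`
only depends on `σ` restricted to `[m-n-1, m+n+1]`. [folklore] -/
theorem severedFlow_cbox_dependsOn (hU : ContDiff ℝ 2 P.U) (hV : ContDiff ℝ 2 P.V)
    (hB1 : P.CondB1) (m : ℤ) (n : ℕ) (t : ℝ) {i : ℤ} (hi : i ∈ Finset.Icc (m - n) (m + n)) :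
    DependsOn (fun σ : ChainConfig => severedFlow hB1 (Finset.Icc (m - n) (m + n)) t σ i)
      (Set.Icc (m - n - 1) (m + n + 1)) := by
  refine DependsOn.mono (fun j hj => ?_) (severedFlow_dependsOn hU hV hB1 _ t hi)
  simp only [Set.mem_setOf_eq, Finset.mem_Icc] at hj
  simp only [Set.mem_Icc]
  omega

end OscillatorChain

/-! ### §2 Canonicity and the rate of convergence for a dynamics with carrier `𝒳₀` -/

namespace InfiniteChainDynamics

open OscillatorChain

variable {P : OscillatorChain} {s₁ s₂ : ℕ} (D : InfiniteChainDynamics P)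

/-- **Canonicity of a `𝒳₀`-dynamics**: for ANY infinite-volume dynamics with carrier `𝒳₀` and
`σ ∈ 𝒳₀`, the severed orbits in the boxes `Λ_{m,n}` (any centre `m`) converge coordinatewise to
`φ_t σ` (its flow agrees on `𝒳₀` with the Buttà–Marchioro flow of `exists_bmDynamics`, by the
`unique` field, and that flow is the limit (3.3) of the partial dynamics).
[cite: ButtaMarchioro2016, §3 eq. (3.3)] -/
theorem tendsto_severedFlow_flow (hs₁ : 1 ≤ s₁) (hs₂ : 1 ≤ s₂) (hU1 : IsEvenPolyOfDegree P.U s₁)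
    (hV1 : IsEvenPolyOfDegree P.V s₂) (hcar : D.carrier = P.bmGood) (hB1 : P.CondB1)
    {σ : ChainConfig} (hσ : σ ∈ P.bmGood) (t : ℝ) (m i : ℤ) :
    Tendsto (fun n : ℕ => severedFlow hB1 (Finset.Icc (m - n) (m + n)) t σ i) atTop
      (𝓝 (D.flow t σ i)) := by
  obtain ⟨D₀, hD₀, -, -, -, hrep, -, -⟩ := exists_bmDynamics hs₁ hs₂ hU1 hV1
  have hσD : σ ∈ D.carrier := by rw [hcar]; exact hσ
  have hmem : ∀ u, D.flow u σ ∈ D₀.carrier := fun u => by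
    rw [hD₀, ← hcar]; exact D.flow_mem hσD u
  have h := D₀.unique (fun u => D.flow u σ) hmem (D.isSolution σ hσD) t
  rw [D.flow_zero σ hσD] at h
  rw [h]
  exact hrep hB1 σ hσ t m i

/-- `(1/64)^n ≤ (1/32)^(n-1)`. [folklore] -/
theorem one_div_pow_le_aux (n : ℕ) : ((1 : ℝ) / 64) ^ n ≤ (1 / 32) ^ (n - 1) :=
  calc ((1 : ℝ) / 64) ^ n ≤ (1 / 32) ^ n := pow_le_pow_left₀ (by norm_num) (by norm_num) n
    _ ≤ (1 / 32) ^ (n - 1) := pow_le_pow_of_le_one (by norm_num) (by norm_num) (Nat.sub_le n 1)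

/-- **Rate of convergence of the partial dynamics to a `𝒳₀`-dynamics at the sites `-1, 0, 1`**
(BM (3.14)–(3.16) with `γ = 1`, `β' = 1`, centre `0`, `k = 1`): there are `A ≥ 1`, `K ≥ 0` with,
for `σ ∈ 𝒳₀`, `t ≥ 0`, `n ≥ 4 + A(1 + t²(1+t) Q(σ))`, `i ∈ {-1, 0, 1}` and `|s| ≤ t`,
`|q_i(φ_s σ) - q_i(T^{Λ_{0,n}}_s σ)|, |p_i(φ_s σ) - p_i(T^{Λ_{0,n}}_s σ)| ≤ (2 + 22 t K Q(σ)) 32^{-(n-1)}`.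
[cite: ButtaMarchioro2016, §3 eqs. (3.14)–(3.16)] -/
theorem exists_flow_sub_severedFlow_le (hs₁ : 1 ≤ s₁) (hs₂ : 1 ≤ s₂)
    (hU1 : IsEvenPolyOfDegree P.U s₁) (hV1 : IsEvenPolyOfDegree P.V s₂)
    (hcar : D.carrier = P.bmGood) (hB1 : P.CondB1) :
    ∃ A K : ℝ, 1 ≤ A ∧ 0 ≤ K ∧ ∀ σ ∈ P.bmGood, ∀ t : ℝ, 0 ≤ t → ∀ n : ℕ,
      4 + A * (1 + t ^ 2 * (1 + t) * P.bmGrowth σ) ≤ n →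
      ∀ i : ℤ, -1 ≤ i → i ≤ 1 → ∀ s : ℝ, |s| ≤ t →
        |(D.flow s σ i).1 - (severedFlow hB1 (Finset.Icc ((0 : ℤ) - n) ((0 : ℤ) + n)) s σ i).1| ≤
            (2 + 22 * t * K * P.bmGrowth σ) * (1 / 32) ^ (n - 1) ∧
        |(D.flow s σ i).2 - (severedFlow hB1 (Finset.Icc ((0 : ℤ) - n) ((0 : ℤ) + n)) s σ i).2| ≤
            (2 + 22 * t * K * P.bmGrowth σ) * (1 / 32) ^ (n - 1) := by
  have hU0 : ∀ r, 0 ≤ P.U r := hU1.choose_spec.2.2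
  have hV0 : ∀ r, 0 ≤ P.V r := hV1.choose_spec.2.2
  have hS1 : (1 : ℝ) ≤ ((max s₁ s₂ : ℕ) : ℝ) := by exact_mod_cast le_max_of_le_left hs₁
  have hS0 : (0 : ℝ) < ((max s₁ s₂ : ℕ) : ℝ) := by linarith
  have hη1 : (((max s₁ s₂ : ℕ) : ℝ) - 1) / ((max s₁ s₂ : ℕ) : ℝ) < 1 := by
    rw [div_lt_one hS0]; linarith
  have hΦ : ∀ x ∈ P.bmGood, ∀ (s : ℝ) (i : ℤ),
      Tendsto (fun n : ℕ => severedFlow hB1 (Finset.Icc ((0 : ℤ) - n) ((0 : ℤ) + n)) s x i) atTop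
        (𝓝 (D.flow s x i)) := fun x hx s i =>
    D.tendsto_severedFlow_flow hs₁ hs₂ hU1 hV1 hcar hB1 hx s 0 i
  obtain ⟨A, K, hA1, hK0, h⟩ :=
    dist_limit_le hs₁ hs₂ hU1 hV1 hB1 hΦ (γ := 1) (β' := 1) hη1 one_lt_two one_pos
  refine ⟨A, K, hA1, hK0, fun σ hσ t ht n hn i hi1 hi2 s hs => ?_⟩
  have hQ1 : 1 ≤ P.bmGrowth σ := one_le_bmGrowth hU0 hV0 hσ
  have hQ0 : 0 ≤ P.bmGrowth σ := zero_le_one.trans hQ1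
  have hL : Real.log (Real.exp 1 + |((0 : ℤ) : ℝ)|) = 1 := by simp
  have hn' : 2 * ((1 : ℕ) : ℝ) + 2 +
      A * (1 + t ^ 2 * (1 + t ^ (1 : ℝ)) * P.bmGrowth σ ^ (1 : ℝ)) ^ (1 / (2 - 1 : ℝ)) *
        Real.log (Real.exp 1 + |((0 : ℤ) : ℝ)|) ≤ n := by
    rw [hL, Real.rpow_one, Real.rpow_one, show (1 / (2 - 1 : ℝ)) = 1 by norm_num, Real.rpow_one]
    push_cast
    linarith
  have hi : i ∈ Finset.Icc ((0 : ℤ) - (1 : ℕ)) ((0 : ℤ) + (1 : ℕ)) := by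
    rw [Finset.mem_Icc]; push_cast; omega
  obtain ⟨hq, hp⟩ := h σ hσ 0 t ht 1 n hn' i hi s hs
  rw [hL] at hp
  simp only [Nat.cast_one] at hp
  have hKQ : 0 ≤ t * K * P.bmGrowth σ := by positivity
  have h32 : (0 : ℝ) ≤ (1 / 32) ^ (n - 1) := by positivity
  have hη : P.bmGrowth σ ^ ((((max s₁ s₂ : ℕ) : ℝ) - 1) / ((max s₁ s₂ : ℕ) : ℝ)) ≤ P.bmGrowth σ :=
    rpow_le_self_of_one_le hQ1 hη1.le
  have hη0 : 0 ≤ P.bmGrowth σ ^ ((((max s₁ s₂ : ℕ) : ℝ) - 1) / ((max s₁ s₂ : ℕ) : ℝ)) :=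
    Real.rpow_nonneg hQ0 _
  refine ⟨hq.trans ?_, hp.trans ?_⟩
  · rw [Nat.add_sub_cancel]
    calc 2 * ((1 : ℝ) / 64) ^ n ≤ 2 * (1 / 32) ^ (n - 1) :=
          mul_le_mul_of_nonneg_left (one_div_pow_le_aux n) (by norm_num)
      _ ≤ (2 + 22 * t * K * P.bmGrowth σ) * (1 / 32) ^ (n - 1) :=
          mul_le_mul_of_nonneg_right (by linarith) h32
  · have e : 2 * (t * K * P.bmGrowth σ ^ ((((max s₁ s₂ : ℕ) : ℝ) - 1) / ((max s₁ s₂ : ℕ) : ℝ)) *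
        (2 * 1 + 2 * 1 + 7) * (1 / 32) ^ (n - 1)) =
        22 * (t * K) * P.bmGrowth σ ^ ((((max s₁ s₂ : ℕ) : ℝ) - 1) / ((max s₁ s₂ : ℕ) : ℝ)) *
          (1 / 32) ^ (n - 1) := by ring
    rw [e]
    have htK : 0 ≤ 22 * (t * K) := by positivity
    calc 22 * (t * K) * P.bmGrowth σ ^ ((((max s₁ s₂ : ℕ) : ℝ) - 1) / ((max s₁ s₂ : ℕ) : ℝ)) *
          (1 / 32) ^ (n - 1)
        ≤ 22 * (t * K) * P.bmGrowth σ * (1 / 32) ^ (n - 1) := by gcongr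
      _ ≤ (2 + 22 * t * K * P.bmGrowth σ) * (1 / 32) ^ (n - 1) :=
          mul_le_mul_of_nonneg_right (by linarith) h32

/-! ### §3 The pointwise locality estimate for polynomially Lipschitz observables -/

/-- `|p| ≤ 2Y` from `p²/2 ≤ Y` and `Y ≥ 1`. [folklore] -/
theorem abs_le_two_mul_of_sq_half_le {p Y : ℝ} (hY : 1 ≤ Y) (h : p ^ 2 / 2 ≤ Y) : |p| ≤ 2 * Y := by
  refine abs_le_of_sq_le_sq ?_ (by linarith)
  nlinarith

/-- **Fixed-time locality of a `𝒳₀`-dynamics, pointwise on `{Q ≤ N}`.** Let `a` be an observable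
which is polynomially Lipschitz in the coordinates at the sites `-1, 0, 1` (hypothesis `ha`: if the
coordinates of `σ'` there are bounded by `R ≥ 1` and those of `σ` are within `δ ≤ 1` of them, then
`|a σ - a σ'| ≤ C_a R^{d_a} δ`). There are constants `A ≥ 1`, `K, L ≥ 0` such that for `N ≥ 1`,
`σ ∈ 𝒳₀` with `Q(σ) ≤ N`, `t ≥ 0`, `n ≥ 4 + A(1 + t²(1+t)N)` with
`δ_n := (2 + 22 t K N) 32^{-(n-1)} ≤ 1`, and `|s| ≤ t`:
`|a(φ_s σ) - a(T^{Λ_{0,n}}_s σ)| ≤ C_a (L N (2n + 7))^{d_a} δ_n` (the coordinates of `T^{Λ_{0,n}}_s σ`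
at `-1, 0, 1` are bounded through the conserved severed energy `≤ W_{0,n+1}(σ) ≤ Q(σ)(2n+7)`).
[cite: ButtaMarchioro2016, §3 eqs. (3.7), (3.14)–(3.16)] -/
theorem exists_abs_sub_comp_severedFlow_le (hs₁ : 1 ≤ s₁) (hs₂ : 1 ≤ s₂)
    (hU1 : IsEvenPolyOfDegree P.U s₁) (hV1 : IsEvenPolyOfDegree P.V s₂)
    (hcar : D.carrier = P.bmGood) (hB1 : P.CondB1)
    {a : ChainConfig → ℝ} {Ca : ℝ} {da : ℕ}
    (ha : ∀ (σ σ' : ChainConfig) (R δ : ℝ), 1 ≤ R → 0 ≤ δ → δ ≤ 1 →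
      (∀ i : ℤ, -1 ≤ i → i ≤ 1 → |(σ' i).1| ≤ R ∧ |(σ' i).2| ≤ R ∧
        |(σ i).1 - (σ' i).1| ≤ δ ∧ |(σ i).2 - (σ' i).2| ≤ δ) → |a σ - a σ'| ≤ Ca * R ^ da * δ) :
    ∃ A K L : ℝ, 1 ≤ A ∧ 0 ≤ K ∧ 0 ≤ L ∧ ∀ N : ℝ, 1 ≤ N → ∀ σ ∈ P.bmGood, P.bmGrowth σ ≤ N →
      ∀ t : ℝ, 0 ≤ t → ∀ n : ℕ, 4 + A * (1 + t ^ 2 * (1 + t) * N) ≤ n →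
      (2 + 22 * t * K * N) * (1 / 32) ^ (n - 1) ≤ 1 →
      ∀ s : ℝ, |s| ≤ t →
        |a (D.flow s σ) - a (severedFlow hB1 (Finset.Icc ((0 : ℤ) - n) ((0 : ℤ) + n)) s σ)| ≤
          Ca * (L * N * (2 * n + 7)) ^ da * ((2 + 22 * t * K * N) * (1 / 32) ^ (n - 1)) := by
  have hU : ContDiff ℝ 2 P.U := hU1.contDiff_two
  have hV : ContDiff ℝ 2 P.V := hV1.contDiff_two
  have hU0 : ∀ r, 0 ≤ P.U r := hU1.choose_spec.2.2
  have hV0 : ∀ r, 0 ≤ P.V r := hV1.choose_spec.2.2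
  have hVe : ∀ r, P.V (-r) = P.V r := fun r => congrFun hV1.comp_neg r
  obtain ⟨A, K, hA1, hK0, hrate⟩ := D.exists_flow_sub_severedFlow_le hs₁ hs₂ hU1 hV1 hcar hB1
  obtain ⟨K₁, K₂, -, hK₂1, -, hposU, -, -, -⟩ := exists_constants hs₁ hs₂ hU1 hV1
  have hK₂0 : 0 ≤ K₂ := zero_le_one.trans hK₂1
  refine ⟨A, K, 2 * K₂, hA1, hK0, by positivity, ?_⟩
  intro N hN σ hσ hQN t ht n hn hδ1 s hs
  have hQ1 : 1 ≤ P.bmGrowth σ := one_le_bmGrowth hU0 hV0 hσ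
  have hQ0 : 0 ≤ P.bmGrowth σ := zero_le_one.trans hQ1
  have hN0 : 0 ≤ N := zero_le_one.trans hN
  -- the rate hypothesis holds since `Q(σ) ≤ N`
  have hnQ : 4 + A * (1 + t ^ 2 * (1 + t) * P.bmGrowth σ) ≤ n := by
    have hA0 : 0 ≤ A := zero_le_one.trans hA1
    have h1 : t ^ 2 * (1 + t) * P.bmGrowth σ ≤ t ^ 2 * (1 + t) * N :=
      mul_le_mul_of_nonneg_left hQN (by positivity)
    nlinarith
  set δ : ℝ := (2 + 22 * t * K * N) * (1 / 32) ^ (n - 1) with hδ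
  have hδ0 : 0 ≤ δ := by positivity
  have hδQ : (2 + 22 * t * K * P.bmGrowth σ) * (1 / 32) ^ (n - 1) ≤ δ := by
    rw [hδ]
    refine mul_le_mul_of_nonneg_right ?_ (by positivity)
    have : t * K * P.bmGrowth σ ≤ t * K * N := mul_le_mul_of_nonneg_left hQN (by positivity)
    linarith
  -- the box `Λ_{0,n}` contains `-1, 0, 1`
  have hn1 : (1 : ℕ) ≤ n := by
    have hA0 : 0 ≤ A * (1 + t ^ 2 * (1 + t) * N) := by
      have : 0 ≤ A := zero_le_one.trans hA1
      positivity
    have : (1 : ℝ) ≤ n := by linarith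
    exact_mod_cast this
  set Λ := Finset.Icc ((0 : ℤ) - n) ((0 : ℤ) + n) with hΛ
  set σ' : ChainConfig := severedFlow hB1 Λ s σ with hσ'
  -- energy bounds for `σ'` at the sites of `Λ`
  set Y := P.bmLocalEnergy 0 (n + 1) σ with hY
  have hY1 : 1 ≤ Y := one_le_bmLocalEnergy hU0 hV0 0 (n + 1) σ
  have hYN : Y ≤ N * (2 * n + 7) := by
    have h := bmLocalEnergy_le hU0 hV0 hσ 0 (n + 1)
    have hL : Real.log (Real.exp 1 + |((0 : ℤ) : ℝ)|) = 1 := by simp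
    rw [hL] at h
    push_cast at h
    have h2 : P.bmGrowth σ * (2 * (n + 1 : ℝ) + 2 * 1 + 3) ≤ N * (2 * n + 7) := by
      have : (0 : ℝ) ≤ 2 * (n + 1 : ℝ) + 2 * 1 + 3 := by positivity
      nlinarith
    exact h.trans h2
  set R : ℝ := 2 * K₂ * N * (2 * n + 7) with hR
  have hYR : K₂ * Y ≤ R := by
    rw [hR]
    have : K₂ * Y ≤ K₂ * (N * (2 * n + 7)) := mul_le_mul_of_nonneg_left hYN hK₂0
    have : 0 ≤ K₂ * (N * (2 * n + 7)) := by positivity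
    nlinarith
  have h2YR : 2 * Y ≤ R := by
    have : 2 * Y ≤ 2 * (N * (2 * n + 7)) := by linarith
    have : N * (2 * n + 7) ≤ K₂ * N * (2 * n + 7) := by
      have : 0 ≤ N * (2 * n + 7) := by positivity
      nlinarith
    rw [hR]; nlinarith
  have hR1 : 1 ≤ R := by
    have : 1 + |((σ' 0).1)| ≤ K₂ * Y := by
      refine hposU Y _ hY1 ?_
      have h0 : (0 : ℤ) ∈ Λ := by rw [hΛ, Finset.mem_Icc]; omega
      exact ((severedFlow_energy_bounds hU hV hU0 hV0 hB1 hVe 0 n σ s).1 0 h0).2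
    linarith [abs_nonneg ((σ' 0).1)]
  have hcoord : ∀ i : ℤ, -1 ≤ i → i ≤ 1 → |(σ' i).1| ≤ R ∧ |(σ' i).2| ≤ R ∧
      |(D.flow s σ i).1 - (σ' i).1| ≤ δ ∧ |(D.flow s σ i).2 - (σ' i).2| ≤ δ := by
    intro i hi1 hi2
    have hiΛ : i ∈ Λ := by
      rw [hΛ, Finset.mem_Icc]; omega
    obtain ⟨hp2, hUq⟩ := (severedFlow_energy_bounds hU hV hU0 hV0 hB1 hVe 0 n σ s).1 i hiΛ
    obtain ⟨hq, hp⟩ := hrate σ hσ t ht n hnQ i hi1 hi2 s hs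
    refine ⟨?_, ?_, hq.trans hδQ, hp.trans hδQ⟩
    · have h := hposU Y _ hY1 hUq
      linarith [abs_nonneg ((σ' i).1)]
    · exact (abs_le_two_mul_of_sq_half_le hY1 hp2).trans h2YR
  have key := ha (D.flow s σ) σ' R δ hR1 hδ0 hδ1 hcoord
  have e : R = 2 * K₂ * N * (2 * n + 7) := hR
  calc |a (D.flow s σ) - a σ'| ≤ Ca * R ^ da * δ := key
    _ = Ca * (2 * K₂ * N * (2 * n + 7)) ^ da * ((2 + 22 * t * K * N) * (1 / 32) ^ (n - 1)) := by
        rw [e, hδ]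

end InfiniteChainDynamics

end Literature.MathematicalPhysics.KineticTheory.HeatConduction

end
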